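import Summits.QuantumFields.YangMills.Theorems.ColdStartUniversalityLatticeLangevinLiebRobinsonCorrelationFreezingBase
import HarnessLib

/-!
# Route `ColdStartUniversality` (fixed-cut-off SZZ dynamics; LIEB–ROBINSON / LOCALITY package, file 23):
# ★★★ EXPONENTIAL CLUSTERING WITH A GENERAL LIGHT-CONE BASE `K ≥ 1` — `|Cov| ≲ K^(−ρ(R+1)/(λ_K+ρ))`, `λ_K = |β'|(4+4√2+12K)`

Helper file (seat `ym-line-csu-p1`, g31; `--supports stmt-QuantumFields-24809`).  The clustering theorems of files 16–17 with the base `108` replaced by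
any `K ≥ 1` (file 22 supplies the light-cone half): at `|β'| < 1/12`, every `L`, crossover time `T_R = (R+1)·log K/(λ_K+ρ)`,
* ★★★ `wilson_covariance_abs_le_base` (every `T`), `doubleSum_profile_le_of_separated_base`, `exp_mul_crossover_mul_pow_eq_base`,
  ★★★ `wilson_covariance_abs_le_of_separated_base` (`(√VarF√VarG + 8Σℓ^FΣℓ^G T_R)e^(−ρT_R)`), ★★★ `…_separated'_base` (`8Σℓ^FΣℓ^G(1+T_R)e^(−ρT_R)`),
  ★★★ `wilson_loop_covariance_abs_le_base` (`32π²|w₁|²|w₂|²(1+T_R)e^(−ρT_R)`), with `e^(−ρT_R) = K^(−ρ(R+1)/(λ_K+ρ))`.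
Reading: the correlation length is at most `(λ_K+ρ)/(ρ·log K)` lattice spacings for EVERY `K ≥ 1`; e.g. `K = 5`, `|β'| = 1/24`: `λ_5 ≈ 2.90`, `ρ = 1/2`,
`ξ ≤ 4.3` (against `≈ 23` with `K = 108`).  THEOREMS ONLY, no definition, no sorry; [folklore] / [cite: ShenZhuZhu2022, §4.3 Cor. 4.11 (shape)].
HONEST FRAMING: fixed cut-off, FIXED strong-coupling window `|β'| < 1/12`; nothing about the route's `β'_K → ∞`; `UniformColdStartMixing` (24809) is NOT
restated; no crux, rung or summit statement is proved; the Yang–Mills mass gap is NOT proved.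
-/

set_option autoImplicit false

noncomputable section

namespace Summit.QuantumFields.YangMills.Theorems.ColdStartUniversality.LiebRobinson

open MeasureTheory ProbabilityTheory Matrix Complex Finset Filter Set Metric intervalIntegral
open scoped ComplexConjugate BigOperators Matrix NNReal ENNReal Topology
open Literature.Probability.Process Literature.MathematicalPhysics.QuantumFieldTheory
open Literature.MathematicalPhysics.QuantumFieldTheory.Balaban1983to89
open Literature.MathematicalPhysics.QuantumLattice (fundamentalRep fundamentalLatticeRep continuous_fundamentalRep fundamentalRep_apply)

variable {L : ℕ} [NeZero L]

/-! ## Clustering with base `K` -/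

/-- ★★★ **Light cone + gap bound on equilibrium covariances** (`|β'| < 1/12`, every torus size `L`).  For `C³` functions `f, g` of the real
link coordinates whose pull-backs `F = f∘coords`, `G = g∘coords` have link-Lipschitz profiles `ℓ^F, ℓ^G ≥ 0`, and every `T ≥ 0`:
`|Cov_(μ_β')(F, G)| ≤ e^(−ρT)·√Var(F)·√Var(G) + 8·T·e^(λT)·Σ_e Σ_e' ℓ^G_e ℓ^F_e' K^(−D(e',e))`, `ρ = 1 − 12|β'|`, `λ = |β'|(4+4√2+12K)`:
interpolate `Cov(F,G) = [∫FG − ∫F·κ_T G] + [∫F·κ_T G − μF·μG]`, the first bracket frozen by the light cone (`wilson_integral_mul_transition_sub_le`,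
after replacing `g` by a compactly supported `C³` function equal to it on the range of `coords`), the second relaxed by the volume-uniform
spectral gap (`wilson_integral_mul_transition_sub_mean_le`).  No dynamics in the statement: the SZZ semigroup is only the interpolating device.
[folklore; cite: ShenZhuZhu2022, §4.3 Cor. 4.11 (shape)] -/
theorem wilson_covariance_abs_le_base (L : ℕ) [NeZero L] (β' : ℝ) (hβ : |β'| < 1 / 12) (K : ℝ) (hK : 1 ≤ K)
    {f : (Edge 3 L × Fin 2 × Fin 2 × Bool → ℝ) → ℝ} (hf : ContDiff ℝ 3 f) {ℓF : Edge 3 L → ℝ} (hℓF : ∀ e, 0 ≤ ℓF e)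
    {g : (Edge 3 L × Fin 2 × Fin 2 × Bool → ℝ) → ℝ} (hg : ContDiff ℝ 3 g) {ℓG : Edge 3 L → ℝ} (hℓG : ∀ e, 0 ≤ ℓG e)
    {T : ℝ} (hT : 0 ≤ T) :
    let coords : GaugeConfig 3 L (Matrix.specialUnitaryGroup (Fin 2) ℂ) → (Edge 3 L × Fin 2 × Fin 2 × Bool → ℝ) :=
      fun V q => (fun z : ℂ => if q.2.2.2 then z.im else z.re)
        ((fundamentalRep (Fin 2) (V q.1) : Matrix (Fin 2) (Fin 2) ℂ) q.2.1 q.2.2.1)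
    (∀ (e : Edge 3 L) (y y' : (GaugeConfig 3 L (Matrix.specialUnitaryGroup (Fin 2) ℂ))), (∀ f', f' ≠ e → y f' = y' f') →
      |f (coords y) - f (coords y')| ≤ ℓF e * frobNorm ((y e : Matrix (Fin 2) (Fin 2) ℂ) - (y' e : Matrix (Fin 2) (Fin 2) ℂ))) →
    (∀ (e : Edge 3 L) (y y' : (GaugeConfig 3 L (Matrix.specialUnitaryGroup (Fin 2) ℂ))), (∀ f', f' ≠ e → y f' = y' f') →
      |g (coords y) - g (coords y')| ≤ ℓG e * frobNorm ((y e : Matrix (Fin 2) (Fin 2) ℂ) - (y' e : Matrix (Fin 2) (Fin 2) ℂ))) →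
    |(∫ x, f (coords x) * g (coords x) ∂(wilsonMeasure (d := 3) (L := L) (fundamentalRep (Fin 2)) β')) - (∫ x, f (coords x) ∂(wilsonMeasure (d := 3) (L := L) (fundamentalRep (Fin 2)) β')) * (∫ x, g (coords x) ∂(wilsonMeasure (d := 3) (L := L) (fundamentalRep (Fin 2)) β'))| ≤
      Real.exp (-((1 - 12 * |β'|) * T)) * Real.sqrt (∫ x, (f (coords x) - ∫ z, f (coords z) ∂(wilsonMeasure (d := 3) (L := L) (fundamentalRep (Fin 2)) β')) ^ 2 ∂(wilsonMeasure (d := 3) (L := L) (fundamentalRep (Fin 2)) β')) * Real.sqrt (∫ x, (g (coords x) - ∫ z, g (coords z) ∂(wilsonMeasure (d := 3) (L := L) (fundamentalRep (Fin 2)) β')) ^ 2 ∂(wilsonMeasure (d := 3) (L := L) (fundamentalRep (Fin 2)) β')) +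
        8 * T * Real.exp ((|β'| * (4 + 4 * Real.sqrt 2 + 12 * K)) * T) * ∑ e : Edge 3 L, ∑ e' : Edge 3 L, ℓG e * ℓF e' * (K⁻¹) ^ (Finset.univ.sup fun i : Fin 3 => ((e'.1 i - e.1 i).valMinAbs).natAbs) := by
  intro coords hLf hLg
  classical
  haveI := secondCountableTopology_su2
  haveI := borelSpace_config L
  set μ : Measure (GaugeConfig 3 L (Matrix.specialUnitaryGroup (Fin 2) ℂ)) := (wilsonMeasure (d := 3) (L := L) (fundamentalRep (Fin 2)) β') with hμ
  haveI : IsProbabilityMeasure μ :=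
    isProbabilityMeasure_wilsonMeasure (d := 3) (L := L) (fundamentalRep (Fin 2)) (continuous_fundamentalRep (Fin 2)) β'
  obtain ⟨κ, hκ, -, hreal⟩ := exists_transitionKernel L β'
  haveI := hκ
  have hco : Continuous coords := continuous_coords (L := L)
  have hFc : Continuous fun V => f (coords V) := hf.continuous.comp hco
  -- a compactly supported `C³` function equal to `g` on the range of `coords`
  obtain ⟨g', hg', hg'c, hg'eq⟩ := exists_compactSupport_eqOn_unitBall (L := L) hg
  have hgg : ∀ V : (GaugeConfig 3 L (Matrix.specialUnitaryGroup (Fin 2) ℂ)), g' (coords V) = g (coords V) :=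
    fun V => hg'eq _ (norm_flatCoords_le_one (L := L) V)
  have hG'c : Continuous fun V => g' (coords V) := hg'.continuous.comp hco
  have hLg' : (∀ (e : Edge 3 L) (y y' : (GaugeConfig 3 L (Matrix.specialUnitaryGroup (Fin 2) ℂ))), (∀ f', f' ≠ e → y f' = y' f') →
      |g' (coords y) - g' (coords y')| ≤ ℓG e * frobNorm ((y e : Matrix (Fin 2) (Fin 2) ℂ) - (y' e : Matrix (Fin 2) (Fin 2) ℂ))) := by
    intro e y y' h; rw [hgg, hgg]; exact hLg e y y' h
  have h1 : |(∫ x, f (coords x) * (∫ y, g' (coords y) ∂(κ T.toNNReal x)) ∂μ) - ∫ x, f (coords x) * g' (coords x) ∂μ| ≤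
      8 * T * Real.exp ((|β'| * (4 + 4 * Real.sqrt 2 + 12 * K)) * T) * ∑ e : Edge 3 L, ∑ e' : Edge 3 L, ℓG e * ℓF e' * (K⁻¹) ^ (Finset.univ.sup fun i : Fin 3 => ((e'.1 i - e.1 i).valMinAbs).natAbs) :=
    wilson_integral_mul_transition_sub_le_base L β' K hK κ hreal hf hℓF hg' hg'c hℓG hT hLf hLg'
  have h2 : |(∫ x, f (coords x) * (∫ y, g' (coords y) ∂(κ T.toNNReal x)) ∂μ) - (∫ x, f (coords x) ∂μ) * (∫ x, g' (coords x) ∂μ)| ≤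
      Real.exp (-((1 - 12 * |β'|) * ((T.toNNReal : ℝ≥0) : ℝ))) * Real.sqrt (∫ x, (f (coords x) - ∫ z, f (coords z) ∂μ) ^ 2 ∂μ) *
        Real.sqrt (∫ x, (g' (coords x) - ∫ z, g' (coords z) ∂μ) ^ 2 ∂μ) :=
    wilson_integral_mul_transition_sub_mean_le L β' hβ κ hreal hFc hG'c T.toNNReal
  have hTc : ((T.toNNReal : ℝ≥0) : ℝ) = T := Real.coe_toNNReal _ hT
  rw [hTc] at h2
  simp only [← hgg]
  calc |(∫ x, f (coords x) * g' (coords x) ∂μ) - (∫ x, f (coords x) ∂μ) * (∫ x, g' (coords x) ∂μ)|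
      = |-((∫ x, f (coords x) * (∫ y, g' (coords y) ∂(κ T.toNNReal x)) ∂μ) - ∫ x, f (coords x) * g' (coords x) ∂μ) +
          ((∫ x, f (coords x) * (∫ y, g' (coords y) ∂(κ T.toNNReal x)) ∂μ) - (∫ x, f (coords x) ∂μ) * (∫ x, g' (coords x) ∂μ))| := by
        congr 1; ring
    _ ≤ |-((∫ x, f (coords x) * (∫ y, g' (coords y) ∂(κ T.toNNReal x)) ∂μ) - ∫ x, f (coords x) * g' (coords x) ∂μ)| +
          |(∫ x, f (coords x) * (∫ y, g' (coords y) ∂(κ T.toNNReal x)) ∂μ) - (∫ x, f (coords x) ∂μ) * (∫ x, g' (coords x) ∂μ)| :=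
        abs_add_le _ _
    _ ≤ 8 * T * Real.exp ((|β'| * (4 + 4 * Real.sqrt 2 + 12 * K)) * T) * (∑ e : Edge 3 L, ∑ e' : Edge 3 L, ℓG e * ℓF e' * (K⁻¹) ^ (Finset.univ.sup fun i : Fin 3 => ((e'.1 i - e.1 i).valMinAbs).natAbs)) +
          Real.exp (-((1 - 12 * |β'|) * T)) * Real.sqrt (∫ x, (f (coords x) - ∫ z, f (coords z) ∂μ) ^ 2 ∂μ) *
            Real.sqrt (∫ x, (g' (coords x) - ∫ z, g' (coords z) ∂μ) ^ 2 ∂μ) := by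
        rw [abs_neg]; exact add_le_add h1 h2
    _ = _ := by rw [add_comm]


/-- **Separated profiles.**  If `ℓ^F` vanishes off `Λ_F`, `ℓ^G` off `Λ_G`, both are nonnegative, and every base site of `Λ_F` is at cyclic
sup-distance `≥ R+1` from every base site of `Λ_G`, then `Σ_e Σ_e' ℓ^G_e ℓ^F_e' K^(−D(e',e)) ≤ K^(−(R+1))·(Σℓ^F)(Σℓ^G)`. [folklore] -/
theorem doubleSum_profile_le_of_separated_base (K : ℝ) (hK : 1 ≤ K) {ℓF ℓG : Edge 3 L → ℝ} (hℓF : ∀ e, 0 ≤ ℓF e) (hℓG : ∀ e, 0 ≤ ℓG e)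
    (Λf Λg : Finset (Edge 3 L)) (hΛf : ∀ e, e ∉ Λf → ℓF e = 0) (hΛg : ∀ e, e ∉ Λg → ℓG e = 0) (R : ℕ)
    (hsep : ∀ e' ∈ Λf, ∀ e ∈ Λg, R + 1 ≤ (Finset.univ.sup fun i : Fin 3 => ((e'.1 i - e.1 i).valMinAbs).natAbs)) :
    ∑ e : Edge 3 L, ∑ e' : Edge 3 L, ℓG e * ℓF e' * (K⁻¹) ^ (Finset.univ.sup fun i : Fin 3 => ((e'.1 i - e.1 i).valMinAbs).natAbs) ≤ (K⁻¹) ^ (R + 1) * ((∑ e : Edge 3 L, ℓF e) * ∑ e : Edge 3 L, ℓG e) := by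
  classical
  have hterm : ∀ e e' : Edge 3 L, ℓG e * ℓF e' * (K⁻¹) ^ (Finset.univ.sup fun i : Fin 3 => ((e'.1 i - e.1 i).valMinAbs).natAbs) ≤ ℓG e * ℓF e' * (K⁻¹) ^ (R + 1) := by
    intro e e'
    by_cases he : e ∈ Λg
    · by_cases he' : e' ∈ Λf
      · exact mul_le_mul_of_nonneg_left (pow_le_pow_of_le_one (inv_nonneg.2 (by linarith)) (inv_le_one_of_one_le₀ hK) (hsep e' he' e he))
          (mul_nonneg (hℓG e) (hℓF e'))
      · rw [hΛf e' he', mul_zero, zero_mul, zero_mul]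
    · rw [hΛg e he, zero_mul, zero_mul, zero_mul]
  calc ∑ e : Edge 3 L, ∑ e' : Edge 3 L, ℓG e * ℓF e' * (K⁻¹) ^ (Finset.univ.sup fun i : Fin 3 => ((e'.1 i - e.1 i).valMinAbs).natAbs) ≤ ∑ e : Edge 3 L, ∑ e' : Edge 3 L, ℓG e * ℓF e' * (K⁻¹) ^ (R + 1) :=
      Finset.sum_le_sum fun e _ => Finset.sum_le_sum fun e' _ => hterm e e'
    _ = (K⁻¹) ^ (R + 1) * ((∑ e : Edge 3 L, ℓF e) * ∑ e : Edge 3 L, ℓG e) := by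
      have hin : ∀ e : Edge 3 L, ∑ e' : Edge 3 L, ℓG e * ℓF e' * (K⁻¹) ^ (R + 1) =
          ℓG e * ((∑ e' : Edge 3 L, ℓF e') * (K⁻¹) ^ (R + 1)) := fun e => by
        rw [Finset.sum_mul, Finset.mul_sum]
        exact Finset.sum_congr rfl fun e' _ => by ring
      rw [Finset.sum_congr rfl fun e _ => hin e, ← Finset.sum_mul]
      ring

omit [NeZero L] in
/-- **The crossover time.**  With `T_R = (R+1)·log K/(λ+ρ)` (`λ = |β'|(4+4√2+12K)`, `ρ = 1 − 12|β'|`, `λ + ρ > 0`), the light-cone factor and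
the relaxation factor coincide: `e^(λ·T_R)·K^(−(R+1)) = e^(−ρ·T_R)`. [folklore] -/
theorem exp_mul_crossover_mul_pow_eq_base (β' : ℝ) (K : ℝ) (hK0 : 0 < K) (R : ℕ) (hden : 0 < (|β'| * (4 + 4 * Real.sqrt 2 + 12 * K)) + (1 - 12 * |β'|)) :
    Real.exp ((|β'| * (4 + 4 * Real.sqrt 2 + 12 * K)) * (((R : ℝ) + 1) * Real.log K / ((|β'| * (4 + 4 * Real.sqrt 2 + 12 * K)) + (1 - 12 * |β'|)))) * (K⁻¹) ^ (R + 1) = Real.exp (-((1 - 12 * |β'|) * (((R : ℝ) + 1) * Real.log K / ((|β'| * (4 + 4 * Real.sqrt 2 + 12 * K)) + (1 - 12 * |β'|))))) := by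
  have hpow : (K⁻¹) ^ (R + 1) = Real.exp (-(((R : ℝ) + 1) * Real.log K)) := by
    rw [Real.exp_neg, show ((R : ℝ) + 1) = ((R + 1 : ℕ) : ℝ) by push_cast; ring, Real.exp_nat_mul,
      Real.exp_log hK0, inv_pow]
  rw [hpow, ← Real.exp_add]
  congr 1
  have hTeq : ((|β'| * (4 + 4 * Real.sqrt 2 + 12 * K)) + (1 - 12 * |β'|)) * (((R : ℝ) + 1) * Real.log K / ((|β'| * (4 + 4 * Real.sqrt 2 + 12 * K)) + (1 - 12 * |β'|))) = ((R : ℝ) + 1) * Real.log K := mul_div_cancel₀ _ hden.ne'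
  linarith

/-- ★★★ **EXPONENTIAL CLUSTERING OF THE `SU(2)` WILSON MEASURE ON THE 3-TORUS AT `|β'| < 1/12`, UNIFORMLY IN THE VOLUME.**  For every torus
size `L`, all `C³` functions `f, g` of the real link coordinates whose pull-backs `F = f∘coords`, `G = g∘coords` have link-Lipschitz profiles
`ℓ^F, ℓ^G ≥ 0` supported in sets of links `Λ_F`, `Λ_G` whose base sites are at cyclic sup-distance `≥ R + 1` from each other:
`|Cov_(μ_β')(F, G)| ≤ (√Var F·√Var G + 8·(Σℓ^F)(Σℓ^G)·T_R)·exp(−ρ·T_R)`,  `T_R = (R+1)·log K/(λ+ρ)`, `ρ = 1 − 12|β'|`, `λ = |β'|(4+4√2+12K)`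
— i.e. correlations decay like `K^(−ρ(R+1)/(λ+ρ))`: a correlation length of at most `(λ+ρ)/(ρ·log K)` lattice spacings, the same for every `L`
(`wilson_covariance_abs_le` at the crossover time `T_R` where the light-cone error `e^(λT)·K^(−(R+1))` meets the relaxation `e^(−ρT)`).
Fixed cut-off, strong-coupling window only; `UniformColdStartMixing` (24809) is NOT restated; the Yang–Mills mass gap is NOT proved.
[folklore; cite: ShenZhuZhu2022, §4.3 Cor. 4.11 / Cor. 1.6 (shape: exponential clustering at strong coupling)] -/
theorem wilson_covariance_abs_le_of_separated_base (L : ℕ) [NeZero L] (β' : ℝ) (hβ : |β'| < 1 / 12) (K : ℝ) (hK : 1 ≤ K)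
    {f : (Edge 3 L × Fin 2 × Fin 2 × Bool → ℝ) → ℝ} (hf : ContDiff ℝ 3 f) {ℓF : Edge 3 L → ℝ} (hℓF : ∀ e, 0 ≤ ℓF e)
    {g : (Edge 3 L × Fin 2 × Fin 2 × Bool → ℝ) → ℝ} (hg : ContDiff ℝ 3 g) {ℓG : Edge 3 L → ℝ} (hℓG : ∀ e, 0 ≤ ℓG e)
    (Λf Λg : Finset (Edge 3 L)) (hΛf : ∀ e, e ∉ Λf → ℓF e = 0) (hΛg : ∀ e, e ∉ Λg → ℓG e = 0) (R : ℕ)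
    (hsep : ∀ e' ∈ Λf, ∀ e ∈ Λg, R + 1 ≤ (Finset.univ.sup fun i : Fin 3 => ((e'.1 i - e.1 i).valMinAbs).natAbs)) :
    let coords : GaugeConfig 3 L (Matrix.specialUnitaryGroup (Fin 2) ℂ) → (Edge 3 L × Fin 2 × Fin 2 × Bool → ℝ) :=
      fun V q => (fun z : ℂ => if q.2.2.2 then z.im else z.re)
        ((fundamentalRep (Fin 2) (V q.1) : Matrix (Fin 2) (Fin 2) ℂ) q.2.1 q.2.2.1)
    (∀ (e : Edge 3 L) (y y' : (GaugeConfig 3 L (Matrix.specialUnitaryGroup (Fin 2) ℂ))), (∀ f', f' ≠ e → y f' = y' f') →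
      |f (coords y) - f (coords y')| ≤ ℓF e * frobNorm ((y e : Matrix (Fin 2) (Fin 2) ℂ) - (y' e : Matrix (Fin 2) (Fin 2) ℂ))) →
    (∀ (e : Edge 3 L) (y y' : (GaugeConfig 3 L (Matrix.specialUnitaryGroup (Fin 2) ℂ))), (∀ f', f' ≠ e → y f' = y' f') →
      |g (coords y) - g (coords y')| ≤ ℓG e * frobNorm ((y e : Matrix (Fin 2) (Fin 2) ℂ) - (y' e : Matrix (Fin 2) (Fin 2) ℂ))) →
    |(∫ x, f (coords x) * g (coords x) ∂(wilsonMeasure (d := 3) (L := L) (fundamentalRep (Fin 2)) β')) - (∫ x, f (coords x) ∂(wilsonMeasure (d := 3) (L := L) (fundamentalRep (Fin 2)) β')) * (∫ x, g (coords x) ∂(wilsonMeasure (d := 3) (L := L) (fundamentalRep (Fin 2)) β'))| ≤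
      (Real.sqrt (∫ x, (f (coords x) - ∫ z, f (coords z) ∂(wilsonMeasure (d := 3) (L := L) (fundamentalRep (Fin 2)) β')) ^ 2 ∂(wilsonMeasure (d := 3) (L := L) (fundamentalRep (Fin 2)) β')) * Real.sqrt (∫ x, (g (coords x) - ∫ z, g (coords z) ∂(wilsonMeasure (d := 3) (L := L) (fundamentalRep (Fin 2)) β')) ^ 2 ∂(wilsonMeasure (d := 3) (L := L) (fundamentalRep (Fin 2)) β')) + 8 * (∑ e : Edge 3 L, ℓF e) * (∑ e : Edge 3 L, ℓG e) * (((R : ℝ) + 1) * Real.log K / ((|β'| * (4 + 4 * Real.sqrt 2 + 12 * K)) + (1 - 12 * |β'|)))) *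
        Real.exp (-((1 - 12 * |β'|) * (((R : ℝ) + 1) * Real.log K / ((|β'| * (4 + 4 * Real.sqrt 2 + 12 * K)) + (1 - 12 * |β'|))))) := by
  intro coords hLf hLg
  classical
  have hK0 : (0 : ℝ) < K := by linarith
  have hlam0 : 0 ≤ (|β'| * (4 + 4 * Real.sqrt 2 + 12 * K)) :=
    mul_nonneg (abs_nonneg _) (by have := Real.sqrt_nonneg 2; linarith)
  have hrho : 0 < (1 - 12 * |β'|) := by linarith
  have hden : 0 < (|β'| * (4 + 4 * Real.sqrt 2 + 12 * K)) + (1 - 12 * |β'|) := by linarith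
  have hlog : 0 ≤ Real.log K := Real.log_nonneg hK
  set T : ℝ := (((R : ℝ) + 1) * Real.log K / ((|β'| * (4 + 4 * Real.sqrt 2 + 12 * K)) + (1 - 12 * |β'|))) with hTdef
  have hT : 0 ≤ T := by rw [hTdef]; exact div_nonneg (mul_nonneg (by positivity) hlog) hden.le
  have key : |(∫ x, f (coords x) * g (coords x) ∂(wilsonMeasure (d := 3) (L := L) (fundamentalRep (Fin 2)) β')) - (∫ x, f (coords x) ∂(wilsonMeasure (d := 3) (L := L) (fundamentalRep (Fin 2)) β')) * (∫ x, g (coords x) ∂(wilsonMeasure (d := 3) (L := L) (fundamentalRep (Fin 2)) β'))| ≤ Real.exp (-((1 - 12 * |β'|) * T)) * Real.sqrt (∫ x, (f (coords x) - ∫ z, f (coords z) ∂(wilsonMeasure (d := 3) (L := L) (fundamentalRep (Fin 2)) β')) ^ 2 ∂(wilsonMeasure (d := 3) (L := L) (fundamentalRep (Fin 2)) β')) * Real.sqrt (∫ x, (g (coords x) - ∫ z, g (coords z) ∂(wilsonMeasure (d := 3) (L := L) (fundamentalRep (Fin 2)) β')) ^ 2 ∂(wilsonMeasure (d := 3) (L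 := L) (fundamentalRep (Fin 2)) β')) + 8 * T * Real.exp ((|β'| * (4 + 4 * Real.sqrt 2 + 12 * K)) * T) * ∑ e : Edge 3 L, ∑ e' : Edge 3 L, ℓG e * ℓF e' * (K⁻¹) ^ (Finset.univ.sup fun i : Fin 3 => ((e'.1 i - e.1 i).valMinAbs).natAbs) :=
    wilson_covariance_abs_le_base L β' hβ K hK hf hℓF hg hℓG hT hLf hLg
  have hS := doubleSum_profile_le_of_separated_base K hK hℓF hℓG Λf Λg hΛf hΛg R hsep
  have hcross : Real.exp ((|β'| * (4 + 4 * Real.sqrt 2 + 12 * K)) * T) * (K⁻¹) ^ (R + 1) = Real.exp (-((1 - 12 * |β'|) * T)) := by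
    rw [hTdef]; exact exp_mul_crossover_mul_pow_eq_base β' K hK0 R hden
  have hVF : 0 ≤ Real.sqrt (∫ x, (f (coords x) - ∫ z, f (coords z) ∂(wilsonMeasure (d := 3) (L := L) (fundamentalRep (Fin 2)) β')) ^ 2 ∂(wilsonMeasure (d := 3) (L := L) (fundamentalRep (Fin 2)) β')) := Real.sqrt_nonneg _
  have hVG : 0 ≤ Real.sqrt (∫ x, (g (coords x) - ∫ z, g (coords z) ∂(wilsonMeasure (d := 3) (L := L) (fundamentalRep (Fin 2)) β')) ^ 2 ∂(wilsonMeasure (d := 3) (L := L) (fundamentalRep (Fin 2)) β')) := Real.sqrt_nonneg _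
  have hSF : 0 ≤ ∑ e : Edge 3 L, ℓF e := Finset.sum_nonneg fun e _ => hℓF e
  have hSG : 0 ≤ ∑ e : Edge 3 L, ℓG e := Finset.sum_nonneg fun e _ => hℓG e
  have hE0 : 0 ≤ Real.exp ((|β'| * (4 + 4 * Real.sqrt 2 + 12 * K)) * T) := (Real.exp_pos _).le
  refine key.trans ?_
  have h2 : 8 * T * Real.exp ((|β'| * (4 + 4 * Real.sqrt 2 + 12 * K)) * T) * ∑ e : Edge 3 L, ∑ e' : Edge 3 L, ℓG e * ℓF e' * (K⁻¹) ^ (Finset.univ.sup fun i : Fin 3 => ((e'.1 i - e.1 i).valMinAbs).natAbs) ≤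
      8 * T * ((∑ e : Edge 3 L, ℓF e) * ∑ e : Edge 3 L, ℓG e) * Real.exp (-((1 - 12 * |β'|) * T)) := by
    calc 8 * T * Real.exp ((|β'| * (4 + 4 * Real.sqrt 2 + 12 * K)) * T) * ∑ e : Edge 3 L, ∑ e' : Edge 3 L, ℓG e * ℓF e' * (K⁻¹) ^ (Finset.univ.sup fun i : Fin 3 => ((e'.1 i - e.1 i).valMinAbs).natAbs)
        ≤ 8 * T * Real.exp ((|β'| * (4 + 4 * Real.sqrt 2 + 12 * K)) * T) * ((K⁻¹) ^ (R + 1) * ((∑ e : Edge 3 L, ℓF e) * ∑ e : Edge 3 L, ℓG e)) :=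
          mul_le_mul_of_nonneg_left hS (by positivity)
      _ = 8 * T * ((∑ e : Edge 3 L, ℓF e) * ∑ e : Edge 3 L, ℓG e) * (Real.exp ((|β'| * (4 + 4 * Real.sqrt 2 + 12 * K)) * T) * (K⁻¹) ^ (R + 1)) := by ring
      _ = _ := by rw [hcross]
  calc Real.exp (-((1 - 12 * |β'|) * T)) * Real.sqrt (∫ x, (f (coords x) - ∫ z, f (coords z) ∂(wilsonMeasure (d := 3) (L := L) (fundamentalRep (Fin 2)) β')) ^ 2 ∂(wilsonMeasure (d := 3) (L := L) (fundamentalRep (Fin 2)) β')) * Real.sqrt (∫ x, (g (coords x) - ∫ z, g (coords z) ∂(wilsonMeasure (d := 3) (L := L) (fundamentalRep (Fin 2)) β')) ^ 2 ∂(wilsonMeasure (d := 3) (L := L) (fundamentalRep (Fin 2)) β')) + 8 * T * Real.exp ((|β'| * (4 + 4 * Real.sqrt 2 + 12 * K)) * T) * ∑ e : Edge 3 L, ∑ e' : Edge 3 L, ℓG e * ℓF e' * (K⁻¹) ^ (Finset.univ.sup fun i : Fin 3 => ((e'.1 i - e.1 i).valMinAbs).natAbs)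
      ≤ Real.exp (-((1 - 12 * |β'|) * T)) * Real.sqrt (∫ x, (f (coords x) - ∫ z, f (coords z) ∂(wilsonMeasure (d := 3) (L := L) (fundamentalRep (Fin 2)) β')) ^ 2 ∂(wilsonMeasure (d := 3) (L := L) (fundamentalRep (Fin 2)) β')) * Real.sqrt (∫ x, (g (coords x) - ∫ z, g (coords z) ∂(wilsonMeasure (d := 3) (L := L) (fundamentalRep (Fin 2)) β')) ^ 2 ∂(wilsonMeasure (d := 3) (L := L) (fundamentalRep (Fin 2)) β')) + 8 * T * ((∑ e : Edge 3 L, ℓF e) * ∑ e : Edge 3 L, ℓG e) * Real.exp (-((1 - 12 * |β'|) * T)) :=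
        add_le_add le_rfl h2
    _ = _ := by ring

/-- ★★★ **Exponential clustering — profile-only form.**  Same setting (`|β'| < 1/12`, every `L`, supports `(R+1)`-separated):
`|Cov_(μ_β')(F, G)| ≤ 8·(Σ_e ℓ^F_e)·(Σ_e ℓ^G_e)·(1 + T_R)·exp(−ρ·T_R)`, `T_R = (R+1) log K/(λ+ρ)` — everything explicit, nothing depends on the
volume (`√Var ≤ 2√2·Σℓ`, `sqrt_variance_le_of_linkLipschitz`).  Fixed cut-off; the Yang–Mills mass gap is NOT proved. [folklore] -/
theorem wilson_covariance_abs_le_of_separated'_base (L : ℕ) [NeZero L] (β' : ℝ) (hβ : |β'| < 1 / 12) (K : ℝ) (hK : 1 ≤ K)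
    {f : (Edge 3 L × Fin 2 × Fin 2 × Bool → ℝ) → ℝ} (hf : ContDiff ℝ 3 f) {ℓF : Edge 3 L → ℝ} (hℓF : ∀ e, 0 ≤ ℓF e)
    {g : (Edge 3 L × Fin 2 × Fin 2 × Bool → ℝ) → ℝ} (hg : ContDiff ℝ 3 g) {ℓG : Edge 3 L → ℝ} (hℓG : ∀ e, 0 ≤ ℓG e)
    (Λf Λg : Finset (Edge 3 L)) (hΛf : ∀ e, e ∉ Λf → ℓF e = 0) (hΛg : ∀ e, e ∉ Λg → ℓG e = 0) (R : ℕ)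
    (hsep : ∀ e' ∈ Λf, ∀ e ∈ Λg, R + 1 ≤ (Finset.univ.sup fun i : Fin 3 => ((e'.1 i - e.1 i).valMinAbs).natAbs)) :
    let coords : GaugeConfig 3 L (Matrix.specialUnitaryGroup (Fin 2) ℂ) → (Edge 3 L × Fin 2 × Fin 2 × Bool → ℝ) :=
      fun V q => (fun z : ℂ => if q.2.2.2 then z.im else z.re)
        ((fundamentalRep (Fin 2) (V q.1) : Matrix (Fin 2) (Fin 2) ℂ) q.2.1 q.2.2.1)
    (∀ (e : Edge 3 L) (y y' : (GaugeConfig 3 L (Matrix.specialUnitaryGroup (Fin 2) ℂ))), (∀ f', f' ≠ e → y f' = y' f') →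
      |f (coords y) - f (coords y')| ≤ ℓF e * frobNorm ((y e : Matrix (Fin 2) (Fin 2) ℂ) - (y' e : Matrix (Fin 2) (Fin 2) ℂ))) →
    (∀ (e : Edge 3 L) (y y' : (GaugeConfig 3 L (Matrix.specialUnitaryGroup (Fin 2) ℂ))), (∀ f', f' ≠ e → y f' = y' f') →
      |g (coords y) - g (coords y')| ≤ ℓG e * frobNorm ((y e : Matrix (Fin 2) (Fin 2) ℂ) - (y' e : Matrix (Fin 2) (Fin 2) ℂ))) →
    |(∫ x, f (coords x) * g (coords x) ∂(wilsonMeasure (d := 3) (L := L) (fundamentalRep (Fin 2)) β')) - (∫ x, f (coords x) ∂(wilsonMeasure (d := 3) (L := L) (fundamentalRep (Fin 2)) β')) * (∫ x, g (coords x) ∂(wilsonMeasure (d := 3) (L := L) (fundamentalRep (Fin 2)) β'))| ≤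
      8 * (∑ e : Edge 3 L, ℓF e) * (∑ e : Edge 3 L, ℓG e) * (1 + (((R : ℝ) + 1) * Real.log K / ((|β'| * (4 + 4 * Real.sqrt 2 + 12 * K)) + (1 - 12 * |β'|)))) * Real.exp (-((1 - 12 * |β'|) * (((R : ℝ) + 1) * Real.log K / ((|β'| * (4 + 4 * Real.sqrt 2 + 12 * K)) + (1 - 12 * |β'|))))) := by
  intro coords hLf hLg
  have key := wilson_covariance_abs_le_of_separated_base L β' hβ K hK hf hℓF hg hℓG Λf Λg hΛf hΛg R hsep hLf hLg
  refine key.trans ?_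
  have hco : Continuous coords := continuous_coords (L := L)
  have hVF := sqrt_variance_le_of_linkLipschitz L β' (hf.continuous.comp hco) hℓF hLf
  have hVG := sqrt_variance_le_of_linkLipschitz L β' (hg.continuous.comp hco) hℓG hLg
  have hK0 : (0 : ℝ) < K := by linarith
  have hlam0 : 0 ≤ (|β'| * (4 + 4 * Real.sqrt 2 + 12 * K)) :=
    mul_nonneg (abs_nonneg _) (by have := Real.sqrt_nonneg 2; linarith)
  have hrho : 0 < (1 - 12 * |β'|) := by linarith
  have hden : 0 < (|β'| * (4 + 4 * Real.sqrt 2 + 12 * K)) + (1 - 12 * |β'|) := by linarith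
  have hlog : 0 ≤ Real.log K := Real.log_nonneg hK
  have hT : 0 ≤ (((R : ℝ) + 1) * Real.log K / ((|β'| * (4 + 4 * Real.sqrt 2 + 12 * K)) + (1 - 12 * |β'|))) := div_nonneg (mul_nonneg (by positivity) hlog) hden.le
  have hSF : 0 ≤ ∑ e : Edge 3 L, ℓF e := Finset.sum_nonneg fun e _ => hℓF e
  have hSG : 0 ≤ ∑ e : Edge 3 L, ℓG e := Finset.sum_nonneg fun e _ => hℓG e
  have hprod : Real.sqrt (∫ x, (f (coords x) - ∫ z, f (coords z) ∂(wilsonMeasure (d := 3) (L := L) (fundamentalRep (Fin 2)) β')) ^ 2 ∂(wilsonMeasure (d := 3) (L := L) (fundamentalRep (Fin 2)) β')) * Real.sqrt (∫ x, (g (coords x) - ∫ z, g (coords z) ∂(wilsonMeasure (d := 3) (L := L) (fundamentalRep (Fin 2)) β')) ^ 2 ∂(wilsonMeasure (d := 3) (L := L) (fundamentalRep (Fin 2)) β')) ≤ 8 * (∑ e : Edge 3 L, ℓF e) * (∑ e : Edge 3 L, ℓG e) := by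
    have hs : Real.sqrt 2 * Real.sqrt 2 = 2 := Real.mul_self_sqrt (by norm_num)
    calc Real.sqrt (∫ x, (f (coords x) - ∫ z, f (coords z) ∂(wilsonMeasure (d := 3) (L := L) (fundamentalRep (Fin 2)) β')) ^ 2 ∂(wilsonMeasure (d := 3) (L := L) (fundamentalRep (Fin 2)) β')) * Real.sqrt (∫ x, (g (coords x) - ∫ z, g (coords z) ∂(wilsonMeasure (d := 3) (L := L) (fundamentalRep (Fin 2)) β')) ^ 2 ∂(wilsonMeasure (d := 3) (L := L) (fundamentalRep (Fin 2)) β')) ≤ (2 * Real.sqrt 2 * ∑ e : Edge 3 L, ℓF e) * (2 * Real.sqrt 2 * ∑ e : Edge 3 L, ℓG e) :=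
        mul_le_mul hVF hVG (Real.sqrt_nonneg _) (by positivity)
      _ = 4 * (Real.sqrt 2 * Real.sqrt 2) * (∑ e : Edge 3 L, ℓF e) * (∑ e : Edge 3 L, ℓG e) := by ring
      _ = 8 * (∑ e : Edge 3 L, ℓF e) * (∑ e : Edge 3 L, ℓG e) := by rw [hs]; ring
  have hE : 0 ≤ Real.exp (-((1 - 12 * |β'|) * (((R : ℝ) + 1) * Real.log K / ((|β'| * (4 + 4 * Real.sqrt 2 + 12 * K)) + (1 - 12 * |β'|))))) := (Real.exp_pos _).le
  calc (Real.sqrt (∫ x, (f (coords x) - ∫ z, f (coords z) ∂(wilsonMeasure (d := 3) (L := L) (fundamentalRep (Fin 2)) β')) ^ 2 ∂(wilsonMeasure (d := 3) (L := L) (fundamentalRep (Fin 2)) β')) * Real.sqrt (∫ x, (g (coords x) - ∫ z, g (coords z) ∂(wilsonMeasure (d := 3) (L := L) (fundamentalRep (Fin 2)) β')) ^ 2 ∂(wilsonMeasure (d := 3) (L := L) (fundamentalRep (Fin 2)) β')) + 8 * (∑ e : Edge 3 L, ℓF e) * (∑ e : Edge 3 L, ℓG e) * (((R : ℝ) + 1)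 * Real.log K / ((|β'| * (4 + 4 * Real.sqrt 2 + 12 * K)) + (1 - 12 * |β'|)))) * Real.exp (-((1 - 12 * |β'|) * (((R : ℝ) + 1) * Real.log K / ((|β'| * (4 + 4 * Real.sqrt 2 + 12 * K)) + (1 - 12 * |β'|)))))
      ≤ (8 * (∑ e : Edge 3 L, ℓF e) * (∑ e : Edge 3 L, ℓG e) + 8 * (∑ e : Edge 3 L, ℓF e) * (∑ e : Edge 3 L, ℓG e) * (((R : ℝ) + 1) * Real.log K / ((|β'| * (4 + 4 * Real.sqrt 2 + 12 * K)) + (1 - 12 * |β'|)))) *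
          Real.exp (-((1 - 12 * |β'|) * (((R : ℝ) + 1) * Real.log K / ((|β'| * (4 + 4 * Real.sqrt 2 + 12 * K)) + (1 - 12 * |β'|))))) := mul_le_mul_of_nonneg_right (add_le_add hprod le_rfl) hE
    _ = _ := by ring


/-- ★★★ **EXPONENTIAL CLUSTERING OF WILSON LOOPS at `|β'| < 1/12`, every volume.**  For any two loop words `w₁, w₂` (lists of oriented links) on
the torus `(ℤ/L)³` whose links have base sites at cyclic sup-distance `≥ R + 1` from each other:
`|⟨Re tr w₁ · Re tr w₂⟩_(μ_β') − ⟨Re tr w₁⟩⟨Re tr w₂⟩| ≤ 32π²·|w₁|²·|w₂|²·(1 + T_R)·e^(−ρ·T_R)`, `T_R = (R+1) log K/(λ+ρ)`, `ρ = 1 − 12|β'|`,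
`λ = |β'|(4+4√2+12K)` — the constants see neither `L` nor the position of the loops (`wilson_covariance_abs_le_of_separated'` with the word profiles
`2π|w|` on the links of `w`, `word_linkLipschitz_profile`).  Plaquette–plaquette: `|w| = 4`.  Fixed cut-off, strong coupling; the Yang–Mills mass
gap is NOT proved. [folklore; cite: ShenZhuZhu2022, Cor. 1.6 (shape)] -/
theorem wilson_loop_covariance_abs_le_base (L : ℕ) [NeZero L] (β' : ℝ) (hβ : |β'| < 1 / 12) (K : ℝ) (hK : 1 ≤ K) (l₁ l₂ : List (Edge 3 L × Bool)) (R : ℕ)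
    (hsep : ∀ e' ∈ (l₁.map Prod.fst).toFinset, ∀ e ∈ (l₂.map Prod.fst).toFinset, R + 1 ≤ (Finset.univ.sup fun i : Fin 3 => ((e'.1 i - e.1 i).valMinAbs).natAbs)) :
    let coords : GaugeConfig 3 L (Matrix.specialUnitaryGroup (Fin 2) ℂ) → (Edge 3 L × Fin 2 × Fin 2 × Bool → ℝ) :=
      fun V q => (fun z : ℂ => if q.2.2.2 then z.im else z.re)
        ((fundamentalRep (Fin 2) (V q.1) : Matrix (Fin 2) (Fin 2) ℂ) q.2.1 q.2.2.1)
    |(∫ x, (fun y : (Edge 3 L × Fin 2 × Fin 2 × Bool → ℝ) => ((l₁.map (fun a : Edge 3 L × Bool => if a.2 then ((fun (ee : Edge 3 L) => Matrix.of fun (i j : Fin 2) => ((y (ee, i, j, false) : ℝ) : ℂ) + ((y (ee, i, j, true) : ℝ) : ℂ) * Complex.I) a.1)ᴴ else (fun (ee : Edge 3 L) => Matrix.of fun (i j : Fin 2) => ((y (ee, i, j, false) : ℝ) : ℂ) + ((y (ee, i, j, true) : ℝ) : ℂ) * Complex.I) a.1)).prod).trace.re) (coords x) * (fun y : (Edge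 3 L × Fin 2 × Fin 2 × Bool → ℝ) => ((l₂.map (fun a : Edge 3 L × Bool => if a.2 then ((fun (ee : Edge 3 L) => Matrix.of fun (i j : Fin 2) => ((y (ee, i, j, false) : ℝ) : ℂ) + ((y (ee, i, j, true) : ℝ) : ℂ) * Complex.I) a.1)ᴴ else (fun (ee : Edge 3 L) => Matrix.of fun (i j : Fin 2) => ((y (ee, i, j, false) : ℝ) : ℂ) + ((y (ee, i, j, true) : ℝ) : ℂ) * Complex.I) a.1)).prod).trace.re) (coords x) ∂(wilsonMeasure (d := 3) (L := L) (fundamentalRep (Fin 2)) β')) -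
        (∫ x, (fun y : (Edge 3 L × Fin 2 × Fin 2 × Bool → ℝ) => ((l₁.map (fun a : Edge 3 L × Bool => if a.2 then ((fun (ee : Edge 3 L) => Matrix.of fun (i j : Fin 2) => ((y (ee, i, j, false) : ℝ) : ℂ) + ((y (ee, i, j, true) : ℝ) : ℂ) * Complex.I) a.1)ᴴ else (fun (ee : Edge 3 L) => Matrix.of fun (i j : Fin 2) => ((y (ee, i, j, false) : ℝ) : ℂ) + ((y (ee, i, j, true) : ℝ) : ℂ) * Complex.I) a.1)).prod).trace.re) (coords x) ∂(wilsonMeasure (d := 3) (L := L) (fundamentalRep (Fin 2)) β')) * (∫ x, (fun y : (Edge 3 L × Fin 2 × Fin 2 × Bool → ℝ) => ((l₂.map (fun a : Edge 3 L × Bool => if a.2 then ((fun (ee : Edge 3 L) => Matrix.of fun (i j : Fin 2) => ((y (ee, i, j, false) : ℝ) : ℂ) + ((y (ee, i, j, true) : ℝ) : ℂ) * Complex.I) a.1)ᴴ else (fun (ee : Edge 3 L) => Matrix.of fun (i j : Fin 2) => ((y (ee, i, j, false) : ℝ) : ℂ) + ((y (ee, i, j, true) : ℝ) : ℂ) * Complex.I)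 a.1)).prod).trace.re) (coords x) ∂(wilsonMeasure (d := 3) (L := L) (fundamentalRep (Fin 2)) β'))| ≤
      32 * Real.pi ^ 2 * (l₁.length : ℝ) ^ 2 * (l₂.length : ℝ) ^ 2 * (1 + (((R : ℝ) + 1) * Real.log K / ((|β'| * (4 + 4 * Real.sqrt 2 + 12 * K)) + (1 - 12 * |β'|)))) * Real.exp (-((1 - 12 * |β'|) * (((R : ℝ) + 1) * Real.log K / ((|β'| * (4 + 4 * Real.sqrt 2 + 12 * K)) + (1 - 12 * |β'|))))) := by
  intro coords
  classical
  set ℓF : Edge 3 L → ℝ := fun e => if e ∈ (l₁.map Prod.fst).toFinset then 2 * Real.pi * (l₁.length : ℝ) else 0 with hℓF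
  set ℓG : Edge 3 L → ℝ := fun e => if e ∈ (l₂.map Prod.fst).toFinset then 2 * Real.pi * (l₂.length : ℝ) else 0 with hℓG
  have hℓF0 : ∀ e, 0 ≤ ℓF e := fun e => by
    simp only [hℓF]; split_ifs
    · positivity
    · exact le_rfl
  have hℓG0 : ∀ e, 0 ≤ ℓG e := fun e => by
    simp only [hℓG]; split_ifs
    · positivity
    · exact le_rfl
  have hΛF : ∀ e, e ∉ (l₁.map Prod.fst).toFinset → ℓF e = 0 := fun e he => by simp only [hℓF, he, if_false]
  have hΛG : ∀ e, e ∉ (l₂.map Prod.fst).toFinset → ℓG e = 0 := fun e he => by simp only [hℓG, he, if_false]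
  have hLf := word_linkLipschitz_profile L β' l₁
  have hLg := word_linkLipschitz_profile L β' l₂
  have key := wilson_covariance_abs_le_of_separated'_base L β' hβ K hK (contDiff_word (L := L) l₁ (m := 3)) hℓF0 (contDiff_word (L := L) l₂ (m := 3)) hℓG0
    (l₁.map Prod.fst).toFinset (l₂.map Prod.fst).toFinset hΛF hΛG R hsep (fun e y y' h => hLf e y y' h) (fun e y y' h => hLg e y y' h)
  refine key.trans ?_
  have hsum : ∀ (l : List (Edge 3 L × Bool)),
      (∑ e : Edge 3 L, (if e ∈ (l.map Prod.fst).toFinset then 2 * Real.pi * (l.length : ℝ) else 0)) ≤ 2 * Real.pi * (l.length : ℝ) ^ 2 := by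
    intro l
    have hcard : (((l.map Prod.fst).toFinset.card : ℕ) : ℝ) ≤ l.length := by
      have h1 := List.toFinset_card_le (l.map Prod.fst)
      rw [List.length_map] at h1
      exact_mod_cast h1
    rw [Finset.sum_ite_mem, Finset.univ_inter, Finset.sum_const, nsmul_eq_mul]
    calc ((l.map Prod.fst).toFinset.card : ℝ) * (2 * Real.pi * (l.length : ℝ)) ≤ (l.length : ℝ) * (2 * Real.pi * (l.length : ℝ)) :=
        mul_le_mul_of_nonneg_right hcard (by positivity)
      _ = 2 * Real.pi * (l.length : ℝ) ^ 2 := by ring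
  have hF := hsum l₁
  have hG := hsum l₂
  have hK0 : (0 : ℝ) < K := by linarith
  have hlam0 : 0 ≤ (|β'| * (4 + 4 * Real.sqrt 2 + 12 * K)) :=
    mul_nonneg (abs_nonneg _) (by have := Real.sqrt_nonneg 2; linarith)
  have hrho : 0 < (1 - 12 * |β'|) := by linarith
  have hden : 0 < (|β'| * (4 + 4 * Real.sqrt 2 + 12 * K)) + (1 - 12 * |β'|) := by linarith
  have hlog : 0 ≤ Real.log K := Real.log_nonneg hK
  have hT : 0 ≤ (((R : ℝ) + 1) * Real.log K / ((|β'| * (4 + 4 * Real.sqrt 2 + 12 * K)) + (1 - 12 * |β'|))) := div_nonneg (mul_nonneg (by positivity) hlog) hden.le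
  have hrest : 0 ≤ (1 + (((R : ℝ) + 1) * Real.log K / ((|β'| * (4 + 4 * Real.sqrt 2 + 12 * K)) + (1 - 12 * |β'|)))) * Real.exp (-((1 - 12 * |β'|) * (((R : ℝ) + 1) * Real.log K / ((|β'| * (4 + 4 * Real.sqrt 2 + 12 * K)) + (1 - 12 * |β'|))))) := mul_nonneg (by linarith) (Real.exp_pos _).le
  have hSF : 0 ≤ ∑ e : Edge 3 L, ℓF e := Finset.sum_nonneg fun e _ => hℓF0 e
  calc 8 * (∑ e : Edge 3 L, ℓF e) * (∑ e : Edge 3 L, ℓG e) * (1 + (((R : ℝ) + 1) * Real.log K / ((|β'| * (4 + 4 * Real.sqrt 2 + 12 * K)) + (1 - 12 * |β'|)))) * Real.exp (-((1 - 12 * |β'|) * (((R : ℝ) + 1) * Real.log K / ((|β'| * (4 + 4 * Real.sqrt 2 + 12 * K)) + (1 - 12 * |β'|)))))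
      = 8 * ((∑ e : Edge 3 L, ℓF e) * (∑ e : Edge 3 L, ℓG e)) * ((1 + (((R : ℝ) + 1) * Real.log K / ((|β'| * (4 + 4 * Real.sqrt 2 + 12 * K)) + (1 - 12 * |β'|)))) * Real.exp (-((1 - 12 * |β'|) * (((R : ℝ) + 1) * Real.log K / ((|β'| * (4 + 4 * Real.sqrt 2 + 12 * K)) + (1 - 12 * |β'|)))))) := by ring
    _ ≤ 8 * ((2 * Real.pi * (l₁.length : ℝ) ^ 2) * (2 * Real.pi * (l₂.length : ℝ) ^ 2)) * ((1 + (((R : ℝ) + 1) * Real.log K / ((|β'| * (4 + 4 * Real.sqrt 2 + 12 * K)) + (1 - 12 * |β'|)))) * Real.exp (-((1 - 12 * |β'|) * (((R : ℝ) + 1) * Real.log K / ((|β'| * (4 + 4 * Real.sqrt 2 + 12 * K)) + (1 - 12 * |β'|)))))) := by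
        refine mul_le_mul_of_nonneg_right (mul_le_mul_of_nonneg_left ?_ (by norm_num)) hrest
        exact mul_le_mul hF hG (Finset.sum_nonneg fun e _ => hℓG0 e) (by positivity)
    _ = _ := by ring


end Summit.QuantumFields.YangMills.Theorems.ColdStartUniversality.LiebRobinson
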